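import Summits.CriticalPhenomena.PercolationContinuityZ3.Theorems.Transplant.FKDoubleFanWedge
import HarnessLib

/-!
# Double fans `K₂ ∨ P_{m+1}`: the SEED CONE — the rank-one operators `W_D, W_a, W_b` are absorbed by one explicit polyhedral operator cone,
# uniformly in `q ∈ [0,1]`; the termwise route reduces to the three polarisations `T_D, T_a, T_b`

Helper file (`--supports stmt-CriticalPhenomena-4575`), FK sub-lane `prim-bschramm-fk-3` (gen 28); builds on p205010 (kernel theorem, internal
audit signed; external expert review pending).  No named facts, no sorries; standard axioms.  Memo `bschramm/prim-bschramm-fk-3/FAR-CROSS-III.md`.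

The invariant-cone principle of `…DoubleFanWedge` (`IsOpCone`, `rayleigh_of_isOpCone`) asks for a convex cone of bivectors stable under SIX operators,
three of which have rank one: `W_a β = β_yv·e_yv`, `W_b β = β_zv·e_zv`, `W_D β = ℓ_D(β)·(a∧b)`.  In the tensor block `V₃ ⊗ V₂` of `∧²ℝ⁵`
(`V₃ = ⟨e_u,e_y,e_z⟩`, `V₂ = ⟨e_x,e_v⟩`) with the bases `(e_y, e_z, a₃ = e_u+e_y+e_z)`, `(e_v, b₂ = e_x+e_v)` all six operators are entrywise
non-negative matrices and the three seeds are basis tensors.  **`seedCone q`** = the six tensor coordinates `≥ 0` plus ONE coupling facet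
`ψ = β_yv − (2−q)β_uv − (1−q)β_xz ≥ 0` (`= ⟨β, γ_{δ₀}⟩/(1−q)`).  Results: **`isOpCone_seedCone`** (`0 ≤ q`; `ψ∘T_D = q·ψ`, `ψ∘T_b = ψ`,
`ψ∘T_a ≥ 0` on the orthant); **`pairH_seedCone_crossB_nonneg`** (pairs `≥ 0` with `s ∧ P_b s` for every `s ∈ InKE q`, `0 ≤ q ≤ 1`; explicit
two-form certificate `seedPair_core` using only masses `≥ 0` and `N^{(ac)}(s) ≥ 0`); **`IsTCone`**, **`IsTCone.isOpCone_sum`**,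
**`IsTCone.pairH_sum_crossB_nonneg`**: a cone stable under `T_D, T_a, T_b` and the axis scalings, carrying the sign conditions
`β_yv, β_zv, ℓ_D(β) ≥ 0`, gives the operator cone `K + seedCone q` with the same positivity — the hypothesis of `rayleigh_crossFar_of_isOpCone`
(`…DoubleFanWedgeWord`) with half the operators.
[cite: Grimmett2006, §3.9 eq. (3.94) (pp. 63–64)] [folklore]
-/

noncomputable section

namespace Summit.CriticalPhenomena.PercolationContinuityZ3.Theorems

namespace FK

namespace ThreeApex

/-! ### The seed cone -/

/-- **The seed cone.**  Bivectors supported in the block `V₃ ⊗ V₂` (`uy = uz = yz = xv = 0`) whose six coordinates in the tensor basis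
`(e_y, e_z, a₃) ⊗ (e_v, b₂)` are non-negative — `c_ab = ux`, `c_av = uv − ux`, `c_yb = −xy − ux`, `c_yv = yv + xy − uv + ux`, `c_zb = −xz − ux`,
`c_zv = zv + xz − uv + ux` — and which satisfy the coupling facet `ψ = yv − (2−q)·uv − (1−q)·xz ≥ 0`. [folklore] -/
def seedCone (q : ℝ) : Set Biv :=
  {β | β.uy = 0 ∧ β.uz = 0 ∧ β.yz = 0 ∧ β.xv = 0 ∧ 0 ≤ β.ux ∧ 0 ≤ β.uv - β.ux ∧ 0 ≤ -β.xy - β.ux ∧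
    0 ≤ β.yv + β.xy - β.uv + β.ux ∧ 0 ≤ -β.xz - β.ux ∧ 0 ≤ β.zv + β.xz - β.uv + β.ux ∧
    0 ≤ β.yv - (2 - q) * β.uv - (1 - q) * β.xz}

/-- The bivector `a ∧ b = e_ux + e_uv − e_xy − e_xz + e_yv + e_zv` (the image direction of `W_D`). [folklore] -/
def bivAB : Biv := ⟨1, 0, 0, 1, -1, -1, 0, 0, 1, 1⟩

/-- The bivector `e_y ∧ e_v` (the image direction of `W_a`). [folklore] -/
def bivYV : Biv := ⟨0, 0, 0, 0, 0, 0, 0, 0, 1, 0⟩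

/-- The bivector `e_z ∧ e_v` (the image direction of `W_b`). [folklore] -/
def bivZV : Biv := ⟨0, 0, 0, 0, 0, 0, 0, 0, 0, 1⟩

/-- `a ∧ b ∈ seedCone q`. [folklore] -/
theorem bivAB_mem_seedCone (q : ℝ) : bivAB ∈ seedCone q := by
  simp only [seedCone, bivAB, Set.mem_setOf_eq]; refine ⟨trivial, trivial, trivial, trivial, ?_, ?_, ?_, ?_, ?_, ?_, ?_⟩ <;> nlinarith

/-- `e_y ∧ e_v ∈ seedCone q`. [folklore] -/
theorem bivYV_mem_seedCone (q : ℝ) : bivYV ∈ seedCone q := by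
  simp only [seedCone, bivYV, Set.mem_setOf_eq]; refine ⟨trivial, trivial, trivial, trivial, ?_, ?_, ?_, ?_, ?_, ?_, ?_⟩ <;> nlinarith

/-- `e_z ∧ e_v ∈ seedCone q`. [folklore] -/
theorem bivZV_mem_seedCone (q : ℝ) : bivZV ∈ seedCone q := by
  simp only [seedCone, bivZV, Set.mem_setOf_eq]; refine ⟨trivial, trivial, trivial, trivial, ?_, ?_, ?_, ?_, ?_, ?_, ?_⟩ <;> nlinarith

/-- `0 ∈ seedCone q` (every `q`). [folklore] -/
theorem zero_mem_seedCone (q : ℝ) : (⟨0, 0, 0, 0, 0, 0, 0, 0, 0, 0⟩ : Biv) ∈ seedCone q := by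
  simp only [seedCone, Set.mem_setOf_eq]; refine ⟨trivial, trivial, trivial, trivial, ?_, ?_, ?_, ?_, ?_, ?_, ?_⟩ <;> nlinarith

/-- `W_D β = ℓ_D(β) • (a∧b)`. [folklore] -/
theorem opWD_eq_smul (q : ℝ) (β : Biv) : opWD q β = Biv.smul (formD q β) bivAB := by
  ext <;> simp [opWD, Biv.smul, bivAB]

/-- `W_a β = β_yv • e_yv`. [folklore] -/
theorem opWa_eq_smul (β : Biv) : opWa β = Biv.smul β.yv bivYV := by
  ext <;> simp [opWa, Biv.smul, bivYV]

/-- `W_b β = β_zv • e_zv`. [folklore] -/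
theorem opWb_eq_smul (β : Biv) : opWb β = Biv.smul β.zv bivZV := by
  ext <;> simp [opWb, Biv.smul, bivZV]

/-- On the seed cone the three seed functionals are non-negative: `β_yv, β_zv, ℓ_D(β) ≥ 0` (`0 ≤ q`). [folklore] -/
theorem seedCone_functionals_nonneg {q : ℝ} (hq0 : 0 ≤ q) {β : Biv} (hβ : β ∈ seedCone q) :
    0 ≤ β.yv ∧ 0 ≤ β.zv ∧ 0 ≤ formD q β := by
  simp only [seedCone, Set.mem_setOf_eq] at hβ
  obtain ⟨-, -, -, -, h5, h6, h7, h8, h9, h10, -⟩ := hβ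
  refine ⟨by linarith, by linarith, ?_⟩
  simp only [formD]
  nlinarith [mul_nonneg hq0 h7, mul_nonneg hq0 h9, mul_nonneg hq0 h6, mul_nonneg (mul_nonneg hq0 hq0) h5]

/-- `seedCone q` is closed under sums. [folklore] -/
theorem seedCone_add_mem {q : ℝ} {β γ : Biv} (hβ : β ∈ seedCone q) (hγ : γ ∈ seedCone q) : Biv.add β γ ∈ seedCone q := by
  simp only [seedCone, Set.mem_setOf_eq] at hβ hγ ⊢
  obtain ⟨b1, b2, b3, b4, b5, b6, b7, b8, b9, b10, b11⟩ := hβ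
  obtain ⟨c1, c2, c3, c4, c5, c6, c7, c8, c9, c10, c11⟩ := hγ
  simp only [Biv.add]
  refine ⟨by rw [b1, c1]; ring, by rw [b2, c2]; ring, by rw [b3, c3]; ring, by rw [b4, c4]; ring, by linarith, by linarith,
    by linarith, by linarith, by linarith, by linarith, by nlinarith⟩

/-- `seedCone q` is closed under non-negative multiples. [folklore] -/
theorem seedCone_smul_mem {q t : ℝ} (ht : 0 ≤ t) {β : Biv} (hβ : β ∈ seedCone q) : Biv.smul t β ∈ seedCone q := by
  simp only [seedCone, Set.mem_setOf_eq] at hβ ⊢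
  obtain ⟨b1, b2, b3, b4, b5, b6, b7, b8, b9, b10, b11⟩ := hβ
  simp only [Biv.smul]
  refine ⟨by rw [b1]; ring, by rw [b2]; ring, by rw [b3]; ring, by rw [b4]; ring, mul_nonneg ht b5, by nlinarith [mul_nonneg ht b6],
    by nlinarith [mul_nonneg ht b7], by nlinarith [mul_nonneg ht b8], by nlinarith [mul_nonneg ht b9], by nlinarith [mul_nonneg ht b10],
    by nlinarith [mul_nonneg ht b11]⟩

/-- `T_D` maps the seed cone into itself (`0 ≤ q`): in tensor coordinates `T_D` is non-negative and `ψ∘T_D = q·ψ`. [folklore] -/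
theorem seedCone_opTD_mem {q : ℝ} (hq0 : 0 ≤ q) {β : Biv} (hβ : β ∈ seedCone q) : opTD q β ∈ seedCone q := by
  simp only [seedCone, Set.mem_setOf_eq] at hβ ⊢
  obtain ⟨b1, b2, b3, b4, b5, b6, b7, b8, b9, b10, b11⟩ := hβ
  simp only [opTD]
  refine ⟨by rw [b1, b2, b3]; ring, by rw [b1, b2, b3]; ring, by rw [b1, b2, b3]; ring, by rw [b4]; ring, ?_, ?_, ?_, ?_, ?_, ?_, ?_⟩
  · nlinarith [mul_nonneg hq0 b5]
  · nlinarith [mul_nonneg hq0 b6]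
  · nlinarith [mul_nonneg hq0 b7]
  · nlinarith [mul_nonneg hq0 b7]
  · nlinarith [mul_nonneg hq0 b9]
  · nlinarith [mul_nonneg hq0 b9]
  · nlinarith [mul_nonneg hq0 b11]

/-- `W_D` maps the seed cone into itself (`0 ≤ q`): `W_D β = ℓ_D(β)·(a∧b)` with `ℓ_D ≥ 0` on the cone. [folklore] -/
theorem seedCone_opWD_mem {q : ℝ} (hq0 : 0 ≤ q) {β : Biv} (hβ : β ∈ seedCone q) : opWD q β ∈ seedCone q := by
  rw [opWD_eq_smul]
  exact seedCone_smul_mem (seedCone_functionals_nonneg hq0 hβ).2.2 (bivAB_mem_seedCone q)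

/-- `T_a` maps the seed cone into itself (`0 ≤ q`). [folklore] -/
theorem seedCone_opTa_mem {q : ℝ} (hq0 : 0 ≤ q) {β : Biv} (hβ : β ∈ seedCone q) : opTa β ∈ seedCone q := by
  simp only [seedCone, Set.mem_setOf_eq] at hβ ⊢
  obtain ⟨b1, b2, b3, b4, b5, b6, b7, b8, b9, b10, b11⟩ := hβ
  simp only [opTa]
  refine ⟨b1, trivial, b3, b4, le_refl _, by linarith, by linarith, by linarith, by linarith, by linarith, ?_⟩
  nlinarith [mul_nonneg hq0 b6, mul_nonneg hq0 b5]

/-- `W_a` maps the seed cone into itself. [folklore] -/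
theorem seedCone_opWa_mem {q : ℝ} (hq0 : 0 ≤ q) {β : Biv} (hβ : β ∈ seedCone q) : opWa β ∈ seedCone q := by
  rw [opWa_eq_smul]
  exact seedCone_smul_mem (seedCone_functionals_nonneg hq0 hβ).1 (bivYV_mem_seedCone q)

/-- `T_b` maps the seed cone into itself (`ψ∘T_b = ψ`). [folklore] -/
theorem seedCone_opTb_mem {q : ℝ} {β : Biv} (hβ : β ∈ seedCone q) : opTb β ∈ seedCone q := by
  simp only [seedCone, Set.mem_setOf_eq] at hβ ⊢
  obtain ⟨b1, b2, b3, b4, b5, b6, b7, b8, b9, b10, b11⟩ := hβ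
  simp only [opTb]
  exact ⟨trivial, b2, b3, b4, le_refl _, by linarith, by linarith, by linarith, by linarith, by linarith, by linarith⟩

/-- `W_b` maps the seed cone into itself. [folklore] -/
theorem seedCone_opWb_mem {q : ℝ} (hq0 : 0 ≤ q) {β : Biv} (hβ : β ∈ seedCone q) : opWb β ∈ seedCone q := by
  rw [opWb_eq_smul]
  exact seedCone_smul_mem (seedCone_functionals_nonneg hq0 hβ).2.1 (bivZV_mem_seedCone q)

/-- The axis scalings map the seed cone into itself (they act by the scalar `1 − w` on the block). [folklore] -/
theorem seedCone_opAB_mem {q w : ℝ} (hw1 : w ≤ 1) {β : Biv} (hβ : β ∈ seedCone q) : opAB w β ∈ seedCone q := by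
  simp only [seedCone, Set.mem_setOf_eq] at hβ ⊢
  obtain ⟨b1, b2, b3, b4, b5, b6, b7, b8, b9, b10, b11⟩ := hβ
  have hw : 0 ≤ 1 - w := by linarith
  simp only [opAB]
  refine ⟨by rw [b1]; ring, by rw [b2]; ring, by rw [b3]; ring, b4, mul_nonneg hw b5, by nlinarith [mul_nonneg hw b6],
    by nlinarith [mul_nonneg hw b7], by nlinarith [mul_nonneg hw b8], by nlinarith [mul_nonneg hw b9], by nlinarith [mul_nonneg hw b10],
    by nlinarith [mul_nonneg hw b11]⟩

/-- **The seed cone is an operator cone** for every `0 ≤ q ≤ 1`: a convex cone mapped into itself by `T_D, W_D, T_a, W_a, T_b, W_b` and the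
axis scalings. [folklore] -/
theorem isOpCone_seedCone {q : ℝ} (hq0 : 0 ≤ q) : IsOpCone q (seedCone q) where
  zero_mem := zero_mem_seedCone q
  add_mem := fun _ _ hβ hγ => seedCone_add_mem hβ hγ
  smul_mem := fun _ _ ht hβ => seedCone_smul_mem ht hβ
  td := fun _ hβ => seedCone_opTD_mem hq0 hβ
  wd := fun _ hβ => seedCone_opWD_mem hq0 hβ
  ta := fun _ hβ => seedCone_opTa_mem hq0 hβ
  wa := fun _ hβ => seedCone_opWa_mem hq0 hβ
  tb := fun _ hβ => seedCone_opTb_mem hβ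
  wb := fun _ hβ => seedCone_opWb_mem hq0 hβ
  ab := fun _ _ _ hw1 hβ => seedCone_opAB_mem hw1 hβ

/-! ### The seed cone pairs non-negatively with the `b`-spoke targets -/

/-- The algebraic core of the pairing estimate: with `A = Z₀·|s|`, `Y = ŷ·|s|`, `X = x̂·ẑ` of a vector `s` with non-negative masses and
`N^{(ac)}(s) ≥ 0`, and with the facet inequalities of the seed cone, `(1−q)·(Y·β_yv − (2−q)·A·β_uv − (1−q)·X·β_xz) ≥ 0`.
Certificate: `(ψ + (1−q)c_av)·E` is an explicit non-negative combination, and `E ≥ 0` directly when `ψ = 0`. [folklore] -/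
theorem seedPair_core {q bux buv bxz byv z0 zab zac zbc z1 : ℝ} (hq1 : q ≤ 1)
    (hux : 0 ≤ bux) (hav : 0 ≤ buv - bux) (hyvuv : 0 ≤ byv - buv) (hzb : 0 ≤ -bxz - bux)
    (hψ : 0 ≤ byv - (2 - q) * buv - (1 - q) * bxz)
    (h0 : 0 ≤ z0) (h1 : 0 ≤ zab) (h2 : 0 ≤ zac) (h3 : 0 ≤ zbc) (h4 : 0 ≤ z1)
    (hN : 0 ≤ zac * (q * z0 + zab + zac + zbc + z1) + (1 - q) * (zab * zbc - z0 * z1)) :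
    0 ≤ (1 - q) * ((z0 + zac) * (z0 + zab + zac + zbc + z1) * byv - (2 - q) * (z0 * (z0 + zab + zac + zbc + z1)) * buv
      - (1 - q) * ((z0 + zab) * (z0 + zbc)) * bxz) := by
  have hp : 0 ≤ 1 - q := by linarith
  have hT : 0 ≤ z0 + zab + zac + zbc + z1 := by linarith
  have hY : 0 ≤ (z0 + zac) * (z0 + zab + zac + zbc + z1) := mul_nonneg (by linarith) hT
  have hX : 0 ≤ (z0 + zab) * (z0 + zbc) := mul_nonneg (by linarith) (by linarith)
  have hYA : 0 ≤ (z0 + zac) * (z0 + zab + zac + zbc + z1) - z0 * (z0 + zab + zac + zbc + z1) := by nlinarith [mul_nonneg h2 hT]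
  have hxz : 0 ≤ -bxz := by linarith
  -- identity (I): form 2
  have hI : (1 - q) * ((z0 + zac) * (z0 + zab + zac + zbc + z1) * byv - (2 - q) * (z0 * (z0 + zab + zac + zbc + z1)) * buv
      - (1 - q) * ((z0 + zab) * (z0 + zbc)) * bxz) =
      (2 - q) * (byv - buv) * ((z0 + zac) * (z0 + zab + zac + zbc + z1) - z0 * (z0 + zab + zac + zbc + z1))
        + (1 - q) * (-bxz) * (zac * (q * z0 + zab + zac + zbc + z1) + (1 - q) * (zab * zbc - z0 * z1))
        + (byv - (2 - q) * buv - (1 - q) * bxz) * ((2 - q) * (z0 * (z0 + zab + zac + zbc + z1))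
            - (z0 + zac) * (z0 + zab + zac + zbc + z1)) := by ring
  -- identity (II): the combined certificate
  have hII : ((byv - (2 - q) * buv - (1 - q) * bxz) + (1 - q) * (buv - bux)) *
      ((1 - q) * ((z0 + zac) * (z0 + zab + zac + zbc + z1) * byv - (2 - q) * (z0 * (z0 + zab + zac + zbc + z1)) * buv
        - (1 - q) * ((z0 + zab) * (z0 + zbc)) * bxz)) =
      (1 - q) * (byv - (2 - q) * buv - (1 - q) * bxz) *
          ((byv - buv) * ((z0 + zac) * (z0 + zab + zac + zbc + z1))
            + bux * (zac * (q * z0 + zab + zac + zbc + z1) + (1 - q) * (zab * zbc - z0 * z1))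
            + (1 - q) * (-bxz - bux) * ((z0 + zab) * (z0 + zbc)))
        + (1 - q) * (buv - bux) *
          ((2 - q) * (byv - buv) * ((z0 + zac) * (z0 + zab + zac + zbc + z1) - z0 * (z0 + zab + zac + zbc + z1))
            + (1 - q) * (-bxz) * (zac * (q * z0 + zab + zac + zbc + z1) + (1 - q) * (zab * zbc - z0 * z1))) := by ring
  have hR1 : 0 ≤ (byv - buv) * ((z0 + zac) * (z0 + zab + zac + zbc + z1))
      + bux * (zac * (q * z0 + zab + zac + zbc + z1) + (1 - q) * (zab * zbc - z0 * z1))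
      + (1 - q) * (-bxz - bux) * ((z0 + zab) * (z0 + zbc)) :=
    add_nonneg (add_nonneg (mul_nonneg hyvuv hY) (mul_nonneg hux hN)) (mul_nonneg (mul_nonneg hp hzb) hX)
  have h2q : 0 ≤ 2 - q := by linarith
  have hR2 : 0 ≤ (2 - q) * (byv - buv) * ((z0 + zac) * (z0 + zab + zac + zbc + z1) - z0 * (z0 + zab + zac + zbc + z1))
      + (1 - q) * (-bxz) * (zac * (q * z0 + zab + zac + zbc + z1) + (1 - q) * (zab * zbc - z0 * z1)) :=
    add_nonneg (mul_nonneg (mul_nonneg h2q hyvuv) hYA) (mul_nonneg (mul_nonneg hp hxz) hN)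
  have hR : 0 ≤ (1 - q) * (byv - (2 - q) * buv - (1 - q) * bxz) *
          ((byv - buv) * ((z0 + zac) * (z0 + zab + zac + zbc + z1))
            + bux * (zac * (q * z0 + zab + zac + zbc + z1) + (1 - q) * (zab * zbc - z0 * z1))
            + (1 - q) * (-bxz - bux) * ((z0 + zab) * (z0 + zbc)))
        + (1 - q) * (buv - bux) *
          ((2 - q) * (byv - buv) * ((z0 + zac) * (z0 + zab + zac + zbc + z1) - z0 * (z0 + zab + zac + zbc + z1))
            + (1 - q) * (-bxz) * (zac * (q * z0 + zab + zac + zbc + z1) + (1 - q) * (zab * zbc - z0 * z1))) :=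
    add_nonneg (mul_nonneg (mul_nonneg hp hψ) hR1) (mul_nonneg (mul_nonneg hp hav) hR2)
  rcases hψ.eq_or_lt with hz | hpos
  · -- `ψ = 0`: form 2 is visibly non-negative
    rw [hI, ← hz, zero_mul, add_zero]
    exact hR2
  · have hfac : 0 < (byv - (2 - q) * buv - (1 - q) * bxz) + (1 - q) * (buv - bux) := by
      have := mul_nonneg hp hav
      linarith
    by_contra hneg
    have hprod := mul_neg_of_pos_of_neg hfac (lt_of_not_ge hneg)
    rw [hII] at hprod
    linarith

/-- The `b`-spoke target bivector `s ∧ P_b s` (`P_b = edgeBC 1 ∗ ·`, `edgeBC 0 ∗ s = s`) in hat–Plücker coordinates. [folklore] -/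
theorem wedgeH_crossB_target (s : V5) :
    wedgeH (conv (edgeBC 0) s) (conv (edgeBC 1) s) =
      ⟨0, 0, s.z0 * (s.z0 + s.zbc), s.z0 * (s.z0 + s.zab + s.zac + s.zbc + s.z1), 0, (s.z0 + s.zab) * (s.z0 + s.zbc),
        (s.z0 + s.zab) * (s.z0 + s.zab + s.zac + s.zbc + s.z1), (s.z0 + s.zac) * (s.z0 + s.zbc),
        (s.z0 + s.zac) * (s.z0 + s.zab + s.zac + s.zbc + s.z1), 0⟩ := by
  ext <;> simp only [wedgeH, conv, edgeBC, hx, hy, hz, V5.total] <;> ring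

/-- **The seed cone pairs non-negatively with every `b`-spoke target**: for `β ∈ seedCone q` and `s ∈ InKE q` (`0 ≤ q ≤ 1`),
`0 ≤ ⟪β, s ∧ P_b s⟫`.  Only the non-negativity of the masses of `s` and `N^{(ac)}(s) ≥ 0` enter. [folklore] -/
theorem pairH_seedCone_crossB_nonneg {q : ℝ} (hq0 : 0 ≤ q) (hq1 : q ≤ 1) {β : Biv} (hβ : β ∈ seedCone q) {s : V5}
    (hs : InKE q s) : 0 ≤ pairH q β (wedgeH (conv (edgeBC 0) s) (conv (edgeBC 1) s)) := by
  have hv := hs.valid hq0 hq1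
  obtain ⟨g0, g1, g2, g3, g4⟩ := hv.nonneg
  have hN : 0 ≤ masterN q s := hv.nAC
  simp only [masterN] at hN
  simp only [seedCone, Set.mem_setOf_eq] at hβ
  obtain ⟨b1, b2, b3, b4, b5, b6, b7, b8, b9, b10, b11⟩ := hβ
  have e : pairH q β (wedgeH (conv (edgeBC 0) s) (conv (edgeBC 1) s)) =
      (1 - q) * ((s.z0 + s.zac) * (s.z0 + s.zab + s.zac + s.zbc + s.z1) * β.yv
        - (2 - q) * (s.z0 * (s.z0 + s.zab + s.zac + s.zbc + s.z1)) * β.uv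
        - (1 - q) * ((s.z0 + s.zab) * (s.z0 + s.zbc)) * β.xz) := by
    rw [wedgeH_crossB_target, pairH, b2, b3, b4]
    ring
  rw [e]
  exact seedPair_core hq1 b5 b6 (by linarith) b9 b11 g0 g1 g2 g3 g4 hN

/-! ### Reduction of the termwise route to the three polarisations -/

/-- **A `T`-cone**: a convex cone of bivectors mapped into itself by the three polarisations `T_D, T_a, T_b` and the axis scalings, on which the
three seed functionals `β_yv, β_zv, ℓ_D(β)` are non-negative.  (No condition for the rank-one operators `W_D, W_a, W_b`.) [folklore] -/
@[folklore] structure IsTCone (q : ℝ) (K : Set Biv) : Prop where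
  /-- `0 ∈ K` -/
  zero_mem : (⟨0, 0, 0, 0, 0, 0, 0, 0, 0, 0⟩ : Biv) ∈ K
  /-- closed under sums -/
  add_mem : ∀ β γ, β ∈ K → γ ∈ K → Biv.add β γ ∈ K
  /-- closed under non-negative multiples -/
  smul_mem : ∀ (a : ℝ) β, 0 ≤ a → β ∈ K → Biv.smul a β ∈ K
  /-- `T_D K ⊆ K` -/
  td : ∀ β, β ∈ K → opTD q β ∈ K
  /-- `T_a K ⊆ K` -/
  ta : ∀ β, β ∈ K → opTa β ∈ K
  /-- `T_b K ⊆ K` -/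
  tb : ∀ β, β ∈ K → opTb β ∈ K
  /-- the axis scalings -/
  ab : ∀ (w : ℝ) β, 0 ≤ w → w ≤ 1 → β ∈ K → opAB w β ∈ K
  /-- `β_yv ≥ 0` on `K` -/
  yv_nonneg : ∀ β, β ∈ K → 0 ≤ β.yv
  /-- `β_zv ≥ 0` on `K` -/
  zv_nonneg : ∀ β, β ∈ K → 0 ≤ β.zv
  /-- `ℓ_D ≥ 0` on `K` -/
  formD_nonneg : ∀ β, β ∈ K → 0 ≤ formD q β

/-- The sum `K + seedCone q`. [folklore] -/
def sumSeed (q : ℝ) (K : Set Biv) : Set Biv := {β | ∃ κ, κ ∈ K ∧ ∃ σ, σ ∈ seedCone q ∧ β = Biv.add κ σ}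

/-- `T_D` is additive. [folklore] -/
theorem opTD_add (q : ℝ) (β γ : Biv) : opTD q (Biv.add β γ) = Biv.add (opTD q β) (opTD q γ) := by
  ext <;> simp only [opTD, Biv.add] <;> ring

/-- `W_D` is additive. [folklore] -/
theorem opWD_add (q : ℝ) (β γ : Biv) : opWD q (Biv.add β γ) = Biv.add (opWD q β) (opWD q γ) := by
  ext <;> simp only [opWD, formD, Biv.add] <;> ring

/-- `T_a` is additive. [folklore] -/
theorem opTa_add (β γ : Biv) : opTa (Biv.add β γ) = Biv.add (opTa β) (opTa γ) := by
  ext <;> simp only [opTa, Biv.add] <;> ring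

/-- `W_a` is additive. [folklore] -/
theorem opWa_add (β γ : Biv) : opWa (Biv.add β γ) = Biv.add (opWa β) (opWa γ) := by
  ext <;> simp only [opWa, Biv.add] <;> ring

/-- `T_b` is additive. [folklore] -/
theorem opTb_add (β γ : Biv) : opTb (Biv.add β γ) = Biv.add (opTb β) (opTb γ) := by
  ext <;> simp only [opTb, Biv.add] <;> ring

/-- `W_b` is additive. [folklore] -/
theorem opWb_add (β γ : Biv) : opWb (Biv.add β γ) = Biv.add (opWb β) (opWb γ) := by
  ext <;> simp only [opWb, Biv.add] <;> ring

/-- The axis scaling is additive. [folklore] -/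
theorem opAB_add (w : ℝ) (β γ : Biv) : opAB w (Biv.add β γ) = Biv.add (opAB w β) (opAB w γ) := by
  ext <;> simp only [opAB, Biv.add] <;> ring

/-- `0 + β = β`. [folklore] -/
theorem Biv.zero_add (β : Biv) : Biv.add ⟨0, 0, 0, 0, 0, 0, 0, 0, 0, 0⟩ β = β := by
  ext <;> simp [Biv.add]

namespace IsTCone

variable {q : ℝ} {K : Set Biv}

/-- `K ⊆ K + seedCone q`. [folklore] -/
theorem mem_sumSeed (q : ℝ) {K : Set Biv} {β : Biv} (hβ : β ∈ K) : β ∈ sumSeed q K :=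
  ⟨β, hβ, _, zero_mem_seedCone q, by ext <;> simp [Biv.add]⟩

/-- **`K + seedCone q` is an operator cone** whenever `K` is a `T`-cone (`0 ≤ q ≤ 1`): the polarisations act on both summands, the rank-one
operators send `K` into the seed cone through the three non-negative seed functionals. [folklore] -/
theorem isOpCone_sum (hK : IsTCone q K) (hq0 : 0 ≤ q) : IsOpCone q (sumSeed q K) where
  zero_mem := mem_sumSeed q hK.zero_mem
  add_mem := by
    rintro β γ ⟨κ, hκ, σ, hσ, rfl⟩ ⟨κ', hκ', σ', hσ', rfl⟩
    refine ⟨Biv.add κ κ', hK.add_mem _ _ hκ hκ', Biv.add σ σ', (isOpCone_seedCone hq0).add_mem _ _ hσ hσ', ?_⟩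
    ext <;> simp only [Biv.add] <;> ring
  smul_mem := by
    rintro t β ht ⟨κ, hκ, σ, hσ, rfl⟩
    refine ⟨Biv.smul t κ, hK.smul_mem _ _ ht hκ, Biv.smul t σ, (isOpCone_seedCone hq0).smul_mem _ _ ht hσ, ?_⟩
    ext <;> simp only [Biv.add, Biv.smul] <;> ring
  td := by
    rintro β ⟨κ, hκ, σ, hσ, rfl⟩
    exact ⟨opTD q κ, hK.td _ hκ, opTD q σ, (isOpCone_seedCone hq0).td _ hσ, opTD_add q κ σ⟩
  wd := by
    rintro β ⟨κ, hκ, σ, hσ, rfl⟩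
    refine ⟨_, hK.zero_mem, Biv.add (opWD q κ) (opWD q σ), (isOpCone_seedCone hq0).add_mem _ _ ?_
      ((isOpCone_seedCone hq0).wd _ hσ), by rw [opWD_add, Biv.zero_add]⟩
    rw [opWD_eq_smul]
    exact (isOpCone_seedCone hq0).smul_mem _ _ (hK.formD_nonneg _ hκ) (bivAB_mem_seedCone q)
  ta := by
    rintro β ⟨κ, hκ, σ, hσ, rfl⟩
    exact ⟨opTa κ, hK.ta _ hκ, opTa σ, (isOpCone_seedCone hq0).ta _ hσ, opTa_add κ σ⟩
  wa := by
    rintro β ⟨κ, hκ, σ, hσ, rfl⟩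
    refine ⟨_, hK.zero_mem, Biv.add (opWa κ) (opWa σ), (isOpCone_seedCone hq0).add_mem _ _ ?_
      ((isOpCone_seedCone hq0).wa _ hσ), by rw [opWa_add, Biv.zero_add]⟩
    rw [opWa_eq_smul]
    exact (isOpCone_seedCone hq0).smul_mem _ _ (hK.yv_nonneg _ hκ) (bivYV_mem_seedCone q)
  tb := by
    rintro β ⟨κ, hκ, σ, hσ, rfl⟩
    exact ⟨opTb κ, hK.tb _ hκ, opTb σ, (isOpCone_seedCone hq0).tb _ hσ, opTb_add κ σ⟩
  wb := by
    rintro β ⟨κ, hκ, σ, hσ, rfl⟩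
    refine ⟨_, hK.zero_mem, Biv.add (opWb κ) (opWb σ), (isOpCone_seedCone hq0).add_mem _ _ ?_
      ((isOpCone_seedCone hq0).wb _ hσ), by rw [opWb_add, Biv.zero_add]⟩
    rw [opWb_eq_smul]
    exact (isOpCone_seedCone hq0).smul_mem _ _ (hK.zv_nonneg _ hκ) (bivZV_mem_seedCone q)
  ab := by
    rintro w β hw0 hw1 ⟨κ, hκ, σ, hσ, rfl⟩
    exact ⟨opAB w κ, hK.ab w _ hw0 hw1 hκ, opAB w σ, (isOpCone_seedCone hq0).ab w _ hw0 hw1 hσ, opAB_add w κ σ⟩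

/-- **Positivity passes to the sum**: if every element of the `T`-cone `K` pairs non-negatively with the `b`-spoke target of `s ∈ InKE q`,
so does every element of `K + seedCone q`. [folklore] -/
theorem pairH_sum_crossB_nonneg (hq0 : 0 ≤ q) (hq1 : q ≤ 1) {s : V5} (hs : InKE q s)
    (hpos : ∀ β, β ∈ K → 0 ≤ pairH q β (wedgeH (conv (edgeBC 0) s) (conv (edgeBC 1) s))) :
    ∀ β, β ∈ sumSeed q K → 0 ≤ pairH q β (wedgeH (conv (edgeBC 0) s) (conv (edgeBC 1) s)) := by
  rintro β ⟨κ, hκ, σ, hσ, rfl⟩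
  have e : pairH q (Biv.add κ σ) (wedgeH (conv (edgeBC 0) s) (conv (edgeBC 1) s)) =
      pairH q κ (wedgeH (conv (edgeBC 0) s) (conv (edgeBC 1) s)) + pairH q σ (wedgeH (conv (edgeBC 0) s) (conv (edgeBC 1) s)) := by
    simp only [pairH, Biv.add]; ring
  rw [e]
  exact add_nonneg (hpos κ hκ) (pairH_seedCone_crossB_nonneg hq0 hq1 hσ hs)

end IsTCone

end ThreeApex

end FK

end Summit.CriticalPhenomena.PercolationContinuityZ3.Theorems
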